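import Literature.ModelTheory.ExponentialFields.DefinablyCompleteExp
import Mathlib.Algebra.Polynomial.Derivative
import Mathlib.Data.Finset.Max
import Mathlib.Data.Set.Card
import HarnessLib

/-!
# Rolle's zero count in definably complete ordered fields, and `exp = polynomial`

Topic `Literature/ModelTheory/ExponentialFields`.  The one-variable root counting behind
Khovanskii's finiteness theorem, carried out *axiomatically* in an ordered field `K` carrying a
definably complete structure (`FirstOrder.Language.IsDefinablyComplete`), i.e. in the models of
the recursive subtheory `OEF ∪ [DC]` of `Th(ℝ_exp)` (`DefinableCompletenessCodes.lean`,
`exists_recursive_subtheory_definablyComplete`) — the setting in which Fornasiero–Servi prove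
Khovanskii's theorem for definable Pfaffian functions (A. Fornasiero, T. Servi, *Definably
complete Baire structures*, Fund. Math. 209 (2010), Theorem 8.4 and §8.2, following
Khovanskii, *Fewnomials* (1991), Ch. III) on the way to the o-minimality of such models
(loc. cit., Theorem 8.2, Corollary 8.3), the semantic core of Macintyre–Wilkie's recursive
axiomatization of `Th(ℝ_exp)` modulo its existential theory.

* **Derivative algebra** for the field derivative `HasFieldDerivAt` of
  `DefinablyCompleteCalculus.lean` (constants, identity, sums, scalar multiples, products,
  powers, polynomials: `hasFieldDerivAt_polynomial_eval`), valid in every topological field;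
* **`IsDefinablyComplete.card_le_card_add_one`** — *Rolle's count*: a definable everywhere
  differentiable `f` has at most `#{f' = 0} + 1` zeros (between two consecutive zeros of `f` lies
  a zero of `f'`, by the definable Rolle theorem `exists_hasFieldDerivAt_eq_zero`; the
  combinatorics is Mathlib's `Finset.card_le_of_interleaved`, as in Mathlib's real-polynomial
  instance `Polynomial.card_roots_toFinset_le_derivative`), with the set version
  `IsDefinablyComplete.finite_setOf_eq_zero_of_deriv`;
* **`IsOrderedExp.finite_setOf_eq_polynomial_eval`** — in a definably complete ordered field
  with `<`, `+`, `·` definable, an ordered exponential `E` (`E(x + y) = E(x)E(y)`, `x + 1 ≤ E(x)`,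
  whence `E' = E`, `DefinablyCompleteExp.lean`) with definable graph agrees with a polynomial
  `p` at no more than `deg p + 1` points: the simplest exponential-polynomial case
  (`n = 1`, one exponential, Pfaffian chain `(exp)`) of Khovanskii's bound over definably
  complete fields (Fornasiero–Servi 2010, Theorem 8.4 (1)), by induction on `deg p`
  (`(E - p)' = E - p'`, and `E - c` has the zero-free derivative `E`).

Everything is proved; nothing here is a named fact.  Definability conventions (`hlt`, `hadd`,
`hmul`, graphs as `{v : Fin 2 → K | v 1 = f (v 0)}`) as in `DefinablyCompleteCalculus.lean`.

## References

* A. Fornasiero, T. Servi, *Definably complete Baire structures*, Fund. Math. 209 (2010),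
  §1.2, Theorem 8.4, §8.2. [FornasieroServi2010]
* A. G. Khovanskii, *Fewnomials*, Transl. Math. Monogr. 88, AMS (1991), Ch. III.
  [Khovanskii1991]
* C. Miller, *Expansions of dense linear orders with the intermediate value property*,
  J. Symbolic Logic 66 (2001). [Miller2001]
-/

open Set FirstOrder FirstOrder.Language Polynomial
open _root_.Filter _root_.Topology

namespace Literature.ModelTheory.ExponentialFields

universe u v

/-! ### Derivative algebra in a topological field -/

section Deriv

variable {K : Type*} [Field K] [TopologicalSpace K] [IsTopologicalRing K]

omit [IsTopologicalRing K] in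
/-- Constants have derivative `0`. [folklore] -/
theorem hasFieldDerivAt_const (c x : K) : HasFieldDerivAt (fun _ => c) 0 x := by
  rw [hasFieldDerivAt_iff]
  refine (tendsto_const_nhds (x := (0 : K))).congr' ?_
  exact eventually_nhdsWithin_of_forall fun y _ => by simp

omit [IsTopologicalRing K] in
/-- The identity has derivative `1`. [folklore] -/
theorem hasFieldDerivAt_id' (x : K) : HasFieldDerivAt (fun y => y) 1 x := by
  rw [hasFieldDerivAt_iff]
  refine (tendsto_const_nhds (x := (1 : K))).congr' ?_
  exact eventually_nhdsWithin_of_forall fun y hy => (div_self (sub_ne_zero.2 hy)).symm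

/-- Sum rule. [folklore] -/
theorem HasFieldDerivAt.add {f g : K → K} {f' g' x : K} (hf : HasFieldDerivAt f f' x)
    (hg : HasFieldDerivAt g g' x) : HasFieldDerivAt (fun y => f y + g y) (f' + g') x := by
  rw [hasFieldDerivAt_iff] at hf hg ⊢
  refine (hf.add hg).congr' (eventually_nhdsWithin_of_forall fun y hy => ?_)
  have hyx : y - x ≠ 0 := sub_ne_zero.2 hy
  field_simp
  ring

/-- Scalar multiples. [folklore] -/
theorem HasFieldDerivAt.const_mul {f : K → K} {f' x : K} (hf : HasFieldDerivAt f f' x)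
    (c : K) : HasFieldDerivAt (fun y => c * f y) (c * f') x := by
  rw [hasFieldDerivAt_iff] at hf ⊢
  refine (hf.const_mul c).congr' (eventually_nhdsWithin_of_forall fun y _ => ?_)
  show c * ((f y - f x) / (y - x)) = (c * f y - c * f x) / (y - x)
  rw [← mul_sub, mul_div_assoc]

/-- Negation. [folklore] -/
theorem HasFieldDerivAt.neg {f : K → K} {f' x : K} (hf : HasFieldDerivAt f f' x) :
    HasFieldDerivAt (fun y => -f y) (-f') x := by
  have h := hf.const_mul (-1)
  simp only [neg_one_mul] at h
  exact h

/-- Difference rule. [folklore] -/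
theorem HasFieldDerivAt.sub {f g : K → K} {f' g' x : K} (hf : HasFieldDerivAt f f' x)
    (hg : HasFieldDerivAt g g' x) : HasFieldDerivAt (fun y => f y - g y) (f' - g') x := by
  have h := hf.add hg.neg
  simpa only [sub_eq_add_neg] using h

/-- **Product rule** (using the continuity of `g` at `x`, `HasFieldDerivAt.continuousAt`).
[folklore] -/
theorem HasFieldDerivAt.mul {f g : K → K} {f' g' x : K} (hf : HasFieldDerivAt f f' x)
    (hg : HasFieldDerivAt g g' x) :
    HasFieldDerivAt (fun y => f y * g y) (f' * g x + f x * g') x := by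
  have hgc : Tendsto g (𝓝[≠] x) (𝓝 (g x)) :=
    hg.continuousAt.tendsto.mono_left nhdsWithin_le_nhds
  rw [hasFieldDerivAt_iff] at hf hg ⊢
  have h := (hf.mul hgc).add (hg.const_mul (f x))
  refine h.congr' (eventually_nhdsWithin_of_forall fun y hy => ?_)
  have hyx : y - x ≠ 0 := sub_ne_zero.2 hy
  field_simp
  ring

/-- Power rule, successor form: `(f^{n+1})' = (n + 1) fⁿ f'`. [folklore] -/
theorem HasFieldDerivAt.pow_succ {f : K → K} {f' x : K} (hf : HasFieldDerivAt f f' x) (n : ℕ) :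
    HasFieldDerivAt (fun y => f y ^ (n + 1)) ((n + 1 : K) * f x ^ n * f') x := by
  induction n with
  | zero => simpa using hf
  | succ n ih =>
    have h := ih.mul hf
    have hfun : (fun y => f y ^ (n + 1) * f y) = fun y => f y ^ (n + 1 + 1) := by
      funext y
      rw [_root_.pow_succ (f y) (n + 1)]
    rw [hfun] at h
    convert h using 1
    push_cast
    ring

/-- Power rule: `(fⁿ)' = n fⁿ⁻¹ f'`. [folklore] -/
theorem HasFieldDerivAt.pow {f : K → K} {f' x : K} (hf : HasFieldDerivAt f f' x) (n : ℕ) :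
    HasFieldDerivAt (fun y => f y ^ n) ((n : K) * f x ^ (n - 1) * f') x := by
  rcases n with _ | n
  · simpa using hasFieldDerivAt_const (1 : K) x
  · have h := hf.pow_succ n
    rw [Nat.add_sub_cancel]
    push_cast
    exact h

/-- **Polynomials are differentiable with the formal derivative**: `(p.eval)' = p.derivative.eval`
in every topological field. [folklore] -/
theorem hasFieldDerivAt_polynomial_eval (p : K[X]) (x : K) :
    HasFieldDerivAt (fun y => p.eval y) (p.derivative.eval x) x := by
  induction p using Polynomial.induction_on' with
  | add p q hp hq =>
    simp only [eval_add, derivative_add]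
    exact hp.add hq
  | monomial n a =>
    simp only [eval_monomial, derivative_monomial]
    have h := ((hasFieldDerivAt_id' x).pow n).const_mul a
    convert h using 1
    ring

end Deriv

/-! ### Definability of polynomial maps -/

section Definable

variable {K : Type*} [Field K] {L : FirstOrder.Language.{u, v}} [L.Structure K]

/-- With the graphs of `+` and `·` definable, `v ↦ p(g v)` is a definable function of tuples for
every polynomial `p` over `K` (coefficients as parameters) and definable `g`. [folklore] -/
theorem definableFun_polynomial_eval {α : Type*}
    (hadd : (univ : Set K).Definable L {v : Fin 3 → K | v 2 = v 0 + v 1})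
    (hmul : (univ : Set K).Definable L {v : Fin 3 → K | v 2 = v 0 * v 1})
    (p : K[X]) {g : (α → K) → K} (hg : (univ : Set K).DefinableFun L g) :
    (univ : Set K).DefinableFun L (fun v => p.eval (g v)) := by
  induction p using Polynomial.induction_on' with
  | add p q hp hq =>
    simp only [eval_add]
    exact definableFun_apply₂_params hadd hp hq
  | monomial n a =>
    simp only [eval_monomial]
    have hpow : ∀ m : ℕ, (univ : Set K).DefinableFun L (fun v => g v ^ m) := by
      intro m
      induction m with
      | zero => simpa using definableFun_const_params (L := L) α (mem_univ (1 : K))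
      | succ m ih =>
        simp only [pow_succ]
        exact definableFun_apply₂_params hmul ih hg
    exact definableFun_apply₂_params hmul (definableFun_const_params (L := L) α (mem_univ a))
      (hpow n)

omit [Field K] in
/-- The graph `{(x, g x)}` of a unary function is definable when `v ↦ g (v 0)` is a definable
function of `2`-tuples. [folklore] -/
theorem definable_graph_of_definableFun {g : K → K}
    (hg : (univ : Set K).DefinableFun L (fun v : Fin 2 → K => g (v 0))) :
    (univ : Set K).Definable L {v : Fin 2 → K | v 1 = g (v 0)} :=
  definable_setOf_eq_params (definableFun_proj_params 1) hg

/-- The graph of subtraction is definable when that of addition is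
(`z = x - y ↔ x = z + y`). [folklore] -/
theorem definable_sub_of_add
    (hadd : (univ : Set K).Definable L {v : Fin 3 → K | v 2 = v 0 + v 1}) :
    (univ : Set K).Definable L {v : Fin 3 → K | v 2 = v 0 - v 1} := by
  have h := hadd.preimage_comp (![2, 1, 0] : Fin 3 → Fin 3)
  refine (congrArg _ ?_).mpr h
  ext v
  simp only [mem_setOf_eq, mem_preimage, Function.comp_apply, Matrix.cons_val_zero,
    Matrix.cons_val_one, Matrix.cons_val]
  constructor
  · intro hv; rw [hv]; ring
  · intro hv; rw [hv]; ring

/-- The graph of `x ↦ E x - p(x)` is definable when those of `+`, `·`, `E` are. [folklore] -/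
theorem definable_graph_sub_polynomial_eval {E : K → K}
    (hadd : (univ : Set K).Definable L {v : Fin 3 → K | v 2 = v 0 + v 1})
    (hmul : (univ : Set K).Definable L {v : Fin 3 → K | v 2 = v 0 * v 1})
    (hE : (univ : Set K).Definable L {v : Fin 2 → K | v 1 = E (v 0)}) (p : K[X]) :
    (univ : Set K).Definable L {v : Fin 2 → K | v 1 = E (v 0) - p.eval (v 0)} := by
  have h1 : (univ : Set K).DefinableFun L (fun v : Fin 2 → K => E (v 0)) :=
    definableFun_apply_params hE (definableFun_proj_params 0)
  have h2 : (univ : Set K).DefinableFun L (fun v : Fin 2 → K => p.eval (v 0)) :=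
    definableFun_polynomial_eval hadd hmul p (definableFun_proj_params 0)
  have h3 : (univ : Set K).DefinableFun L (fun v : Fin 2 → K => E (v 0) - p.eval (v 0)) :=
    definableFun_apply₂_params (definable_sub_of_add hadd) h1 h2
  exact definable_graph_of_definableFun (g := fun y => E y - p.eval y) h3

end Definable

/-! ### Rolle's zero count -/

section Count

variable {K : Type*} [Field K] [LinearOrder K] [IsStrictOrderedRing K] [TopologicalSpace K]
  [OrderTopology K] {L : FirstOrder.Language.{u, v}} [L.Structure K] {f f' : K → K}

/-- **Rolle's count** in a definably complete ordered field: if `f` (definable graph) is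
differentiable everywhere with derivative `f'`, `s` is a finite set of zeros of `f` and the
finite set `t` contains every zero of `f'`, then `#s ≤ #t + 1` — between two consecutive points
of `s` the definable Rolle theorem puts a point of `t` (Mathlib's `Finset.card_le_of_interleaved`).
The graphs of `<` and `+` are assumed definable (for Rolle). [folklore] -/
theorem _root_.FirstOrder.Language.IsDefinablyComplete.card_le_card_add_one
    (hDC : L.IsDefinablyComplete K)
    (hlt : (univ : Set K).Definable L {v : Fin 2 → K | v 0 < v 1})
    (hadd : (univ : Set K).Definable L {v : Fin 3 → K | v 2 = v 0 + v 1})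
    (hf : (univ : Set K).Definable L {v : Fin 2 → K | v 1 = f (v 0)})
    (hder : ∀ x, HasFieldDerivAt f (f' x) x) {s t : Finset K} (hs : ∀ x ∈ s, f x = 0)
    (ht : ∀ x, f' x = 0 → x ∈ t) : s.card ≤ t.card + 1 := by
  have hcont : Continuous f := continuous_iff_continuousAt.2 fun x => (hder x).continuousAt
  refine Finset.card_le_of_interleaved fun x hx y hy hxy _ => ?_
  obtain ⟨z, hz, hz0⟩ := hDC.exists_hasFieldDerivAt_eq_zero hlt hadd hf hxy hcont.continuousOn
    (fun w _ => hder w) ((hs x hx).trans (hs y hy).symm)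
  exact ⟨z, ht z hz0, hz.1, hz.2⟩

/-- **Finitely many critical points give finitely many zeros**: with `f` as above, if `f'` has
finitely many zeros then so does `f`, and `#{f = 0} ≤ #{f' = 0} + 1`. [folklore] -/
theorem _root_.FirstOrder.Language.IsDefinablyComplete.finite_setOf_eq_zero_of_deriv
    (hDC : L.IsDefinablyComplete K)
    (hlt : (univ : Set K).Definable L {v : Fin 2 → K | v 0 < v 1})
    (hadd : (univ : Set K).Definable L {v : Fin 3 → K | v 2 = v 0 + v 1})
    (hf : (univ : Set K).Definable L {v : Fin 2 → K | v 1 = f (v 0)})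
    (hder : ∀ x, HasFieldDerivAt f (f' x) x) (hfin : {x | f' x = 0}.Finite) :
    {x | f x = 0}.Finite ∧ {x | f x = 0}.ncard ≤ {x | f' x = 0}.ncard + 1 := by
  have key : ∀ s : Finset K, (∀ x ∈ s, f x = 0) → s.card ≤ hfin.toFinset.card + 1 :=
    fun s hs => hDC.card_le_card_add_one hlt hadd hf hder hs fun x hx => hfin.mem_toFinset.2 hx
  have hfinite : {x | f x = 0}.Finite := by
    rcases Set.finite_or_infinite {x | f x = 0} with h | h
    · exact h
    · obtain ⟨s, hs, hcard⟩ := h.exists_subset_card_eq (hfin.toFinset.card + 2)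
      have := key s fun x hx => hs (Finset.mem_coe.2 hx)
      omega
  refine ⟨hfinite, ?_⟩
  rw [Set.ncard_eq_toFinset_card _ hfinite, Set.ncard_eq_toFinset_card _ hfin]
  exact key _ fun x hx => hfinite.mem_toFinset.1 hx

/-! ### An ordered exponential meets a polynomial of degree `d` in at most `d + 1` points -/

/-- One Rolle step for `E - p`: if `E - p'` has finitely many zeros then so has `E - p`, at most
one more. [folklore] -/
theorem IsOrderedExp.finite_setOf_sub_polynomial_eval_step {E : K → K} (hE : IsOrderedExp E)
    (hDC : L.IsDefinablyComplete K)
    (hlt : (univ : Set K).Definable L {v : Fin 2 → K | v 0 < v 1})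
    (hadd : (univ : Set K).Definable L {v : Fin 3 → K | v 2 = v 0 + v 1})
    (hmul : (univ : Set K).Definable L {v : Fin 3 → K | v 2 = v 0 * v 1})
    (hEdef : (univ : Set K).Definable L {v : Fin 2 → K | v 1 = E (v 0)}) (p : K[X])
    (hfin : {x | E x - p.derivative.eval x = 0}.Finite) :
    {x | E x - p.eval x = 0}.Finite ∧
      {x | E x - p.eval x = 0}.ncard ≤ {x | E x - p.derivative.eval x = 0}.ncard + 1 :=
  hDC.finite_setOf_eq_zero_of_deriv hlt hadd (f := fun y => E y - p.eval y)
    (f' := fun y => E y - p.derivative.eval y) (definable_graph_sub_polynomial_eval hadd hmul hEdef p)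
    (fun x => (hE.hasFieldDerivAt x).sub (hasFieldDerivAt_polynomial_eval p x)) hfin

/-- **An ordered exponential agrees with a polynomial of degree `≤ d` at no more than `d + 1`
points** of a definably complete ordered field in which `<`, `+`, `·` and the graph of `E` are
definable — the case `n = 1`, chain `(exp)`, of Khovanskii's bound for Pfaffian functions over
definably complete fields (Fornasiero–Servi 2010, Theorem 8.4 (1); Khovanskii 1991, Ch. III
for `ℝ`), by induction on `d`: `(E - p)' = E - p'`, and for constant `p` the derivative `E`
has no zeros (`E > 0`). [cite: FornasieroServi2010, Theorem 8.4] -/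
theorem IsOrderedExp.finite_setOf_eq_polynomial_eval {E : K → K} (hE : IsOrderedExp E)
    (hDC : L.IsDefinablyComplete K)
    (hlt : (univ : Set K).Definable L {v : Fin 2 → K | v 0 < v 1})
    (hadd : (univ : Set K).Definable L {v : Fin 3 → K | v 2 = v 0 + v 1})
    (hmul : (univ : Set K).Definable L {v : Fin 3 → K | v 2 = v 0 * v 1})
    (hEdef : (univ : Set K).Definable L {v : Fin 2 → K | v 1 = E (v 0)}) (p : K[X]) :
    {x | E x = p.eval x}.Finite ∧ {x | E x = p.eval x}.ncard ≤ p.natDegree + 1 := by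
  suffices h : ∀ d : ℕ, ∀ q : K[X], q.natDegree ≤ d →
      {x | E x - q.eval x = 0}.Finite ∧ {x | E x - q.eval x = 0}.ncard ≤ d + 1 by
    simpa only [sub_eq_zero] using h p.natDegree p le_rfl
  intro d
  induction d with
  | zero =>
    intro q hq
    have hq0 : q.derivative = 0 := derivative_of_natDegree_zero (Nat.le_zero.1 hq)
    have hempty : {x | E x - q.derivative.eval x = 0} = ∅ := by
      ext x
      simp only [hq0, eval_zero, sub_zero, mem_setOf_eq, mem_empty_iff_false, iff_false]
      exact (hE.pos x).ne'
    have hstep := hE.finite_setOf_sub_polynomial_eval_step hDC hlt hadd hmul hEdef q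
      (by rw [hempty]; exact finite_empty)
    rw [hempty, ncard_empty] at hstep
    exact hstep
  | succ d ih =>
    intro q hq
    have hq' : q.derivative.natDegree ≤ d := by
      have := natDegree_derivative_le q
      omega
    obtain ⟨hfin', hcard'⟩ := ih q.derivative hq'
    obtain ⟨hfin, hcard⟩ := hE.finite_setOf_sub_polynomial_eval_step hDC hlt hadd hmul hEdef q hfin'
    exact ⟨hfin, hcard.trans (by omega)⟩

/-- **`E x = a x + b` has at most two solutions** (and `E x = c` at most one): the
transversality count of lines against the graph of the exponential, a case of the preceding
theorem. [folklore] -/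
theorem IsOrderedExp.ncard_setOf_eq_linear_le_two {E : K → K} (hE : IsOrderedExp E)
    (hDC : L.IsDefinablyComplete K)
    (hlt : (univ : Set K).Definable L {v : Fin 2 → K | v 0 < v 1})
    (hadd : (univ : Set K).Definable L {v : Fin 3 → K | v 2 = v 0 + v 1})
    (hmul : (univ : Set K).Definable L {v : Fin 3 → K | v 2 = v 0 * v 1})
    (hEdef : (univ : Set K).Definable L {v : Fin 2 → K | v 1 = E (v 0)}) (a b : K) :
    {x | E x = a * x + b}.Finite ∧ {x | E x = a * x + b}.ncard ≤ 2 := by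
  have h := hE.finite_setOf_eq_polynomial_eval hDC hlt hadd hmul hEdef (C a * X + C b)
  simp only [eval_add, eval_mul, eval_C, eval_X] at h
  refine ⟨h.1, h.2.trans ?_⟩
  have : (C a * X + C b).natDegree ≤ 1 := natDegree_linear_le
  omega

end Count

end Literature.ModelTheory.ExponentialFields
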